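import Summits.BirchSwinnertonDyer.BirchSwinnertonDyer.Theorems.BiquadraticEisensteinDescentEisensteinHeartFlatCMInertBadKPrimeDeuringOverKPrime
import Literature.NumberTheory.NumberFields.QuadraticExtensionFrobeniusProofs
import HarnessLib

set_option linter.dupNamespace false -- `Summit.BirchSwinnertonDyer.BirchSwinnertonDyer.Theorems.…` (summit = sub)
set_option autoImplicit false

/-!
# Crux `EisensteinHeartFlatCMInertBadKPrime` (stmt-BirchSwinnertonDyer-21341), line `hsieh-lambda`, layer 2 (V2), hypothesis (L):
# the side condition `hdeg` of `…DeuringOverKPrime.polynomial_identity` reduced to the CM field alone (Frobenius at an inert place)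

Route `BiquadraticEisensteinDescent` (cell `pub/bsd-wall`, width seat `bsd-wall-cm-bed-w3`). THEOREMS ONLY (no definition, no named
fact, no `sorry`); supports stmt-BirchSwinnertonDyer-21341 as a helper; nothing about the crux's input or any case of BSD is asserted.

`hdeg` ("a prime `v` of `K′` inert in `L/K′` has residue degree `1` over `ℚ`", i.e. the biquadratic field `L = K_CM·K′` has no place of
residue degree `4`) is PROVED here (`absNorm_eq_minFac_of_inertiaDeg_eq_two`) from data on the CM field `K₁` only: an algebraic
integer `θ₀ ∈ 𝓞 K₁` and `a ∈ ℤ` with `c θ₀ = a − θ₀` (`θ₀ = (1+√d)/2`, `a = 1`; or `θ₀ = √d`, `a = 0`) such that `a − 2θ₀` (`= ∓√d`,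
`−2√d`) lies in NO prime of `K₁` of residue degree `2` (for the nine CM fields: `√d ∈ 𝔮 ⇒ ℓ ∣ d ⇒ ℓ` ramified, not inert). Proof: if
`N(v) = ℓ²` and `f(w|v) = 2` then `N(w) = ℓ⁴`, so the trace `𝔮 = w ∩ 𝓞 K₁` is inert (`N(𝔮) = ℓ²`, `f(w|𝔮) = 2`); `τ` is the
Frobenius at `w` (`QuadraticExtensionFrobeniusProofs.smul_sub_pow_absNorm_mem_of_inertiaDeg_eq_two`): `a − θ₀ = τθ₀ ≡ θ₀^{ℓ²}
≡ θ₀ (mod w)` (Fermat in `𝓞 K₁/𝔮`), so `a − 2θ₀ ∈ w ∩ 𝓞 K₁ = 𝔮`, contradiction.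

References: [NeukirchANT1999] Ch. I §8 (8.2)–(8.4), §9 (9.4)–(9.6); [Marcus2018] Ch. 4 Thm. 28 and Ex. (biquadratic fields);
[SilvermanATAEC1994] App. A §3 (the nine CM fields).
-/

noncomputable section

open scoped NumberField Pointwise
open NumberField IsDedekindDomain Ideal
open Literature.NumberTheory.GaloisRepresentations Literature.NumberTheory.EllipticCurves Literature.NumberTheory.NumberFields
open Literature.NumberTheory.Automorphic

namespace Summit.BirchSwinnertonDyer.BirchSwinnertonDyer.Theorems.BiquadraticEisensteinDescentEisensteinHeartFlatCMInertBadKPrimeDeuringOverKPrimeResidueDegree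

variable {K₁ K L : Type} [Field K₁] [NumberField K₁] [Field K] [NumberField K] [Field L] [NumberField L]
  [Algebra K₁ L] [IsGalois K₁ L] [Algebra K L] [IsGalois K L] [IsGalois ℚ K₁]

omit [IsGalois K₁ L] [IsGalois K L] in
/-- `τ ∈ Gal(L/K)` acts on `𝓞 K₁ ⊆ 𝓞 L` through `(τ|_ℚ)|_{K₁}` (the tree's `tower_smul_algebraMap`). [folklore] -/
theorem smul_algebraMap_eq (τ : L ≃ₐ[K] L) (x : 𝓞 K₁) :
    τ • (algebraMap (𝓞 K₁) (𝓞 L) x) = algebraMap (𝓞 K₁) (𝓞 L) (((τ.restrictScalars ℚ).restrictNormal K₁) • x) := by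
  rw [← tower_smul_algebraMap (K := ℚ) (K' := K₁) (L := L) (τ.restrictScalars ℚ) x]
  rfl

omit [NumberField L] [IsGalois K₁ L] [Algebra K L] [IsGalois K L] [IsGalois ℚ K₁] [NumberField K] [Field K] in
/-- Fermat in the residue field: `x^{N(𝔮)} − x ∈ 𝔮` for `x ∈ 𝓞 K₁`. [cite: NeukirchANT1999, Ch. I §9 (9.4)] -/
theorem pow_absNorm_sub_mem (𝔮 : HeightOneSpectrum (𝓞 K₁)) (x : 𝓞 K₁) :
    x ^ Ideal.absNorm 𝔮.asIdeal - x ∈ 𝔮.asIdeal := by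
  classical
  haveI : 𝔮.asIdeal.IsMaximal := 𝔮.isMaximal
  letI : Field (𝓞 K₁ ⧸ 𝔮.asIdeal) := Ideal.Quotient.field 𝔮.asIdeal
  haveI : Finite (𝓞 K₁ ⧸ 𝔮.asIdeal) := Ideal.finiteQuotientOfFreeOfNeBot 𝔮.asIdeal 𝔮.ne_bot
  letI : Fintype (𝓞 K₁ ⧸ 𝔮.asIdeal) := Fintype.ofFinite _
  rw [← Ideal.Quotient.eq, map_pow, Ideal.absNorm_apply, Submodule.cardQuot_apply, Nat.card_eq_fintype_card]
  exact FiniteField.pow_card _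

omit [NumberField L] [IsGalois K₁ L] [Algebra K L] [IsGalois K L] [IsGalois ℚ K₁] [NumberField K] [Field K] in
/-- Iterated Fermat: `x^{N(𝔮)²} − x ∈ 𝔮`. [cite: NeukirchANT1999, Ch. I §9 (9.4)] -/
theorem pow_absNorm_sq_sub_mem (𝔮 : HeightOneSpectrum (𝓞 K₁)) (x : 𝓞 K₁) :
    x ^ (Ideal.absNorm 𝔮.asIdeal ^ 2) - x ∈ 𝔮.asIdeal := by
  have h1 := pow_absNorm_sub_mem 𝔮 x
  have h2 := pow_absNorm_sub_mem 𝔮 (x ^ Ideal.absNorm 𝔮.asIdeal)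
  rw [← pow_mul, ← sq] at h2
  have := 𝔮.asIdeal.add_mem h2 h1
  rwa [sub_add_sub_cancel] at this

/-- **`hdeg` from the CM field: a prime of `K′` inert in `L/K′` has residue degree one over `ℚ`.** Setting: `K₁` (CM field, Galois
over `ℚ`, `[K₁:ℚ] = 2`), `K` (`= K′`, `[K:ℚ] = 2`), `L ⊇ K, K₁` with `L/K` and `L/K₁` quadratic Galois, `τ ∈ Gal(L/K)` non-trivial
acting on `K₁` as `c`; `θ₀ ∈ 𝓞 K₁`, `a ∈ ℤ` with `c θ₀ = a − θ₀` and `a − 2θ₀ ∉ 𝔮` for every prime `𝔮` of `K₁` with `N(𝔮) = ℓ²`.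
Then for every `w ∣ v` with `f(w|v) = 2`: `N(v) = ℓ` (`= N(v).minFac`). See the module docstring for the Frobenius argument.
[cite: NeukirchANT1999, Ch. I §9 (9.4)–(9.6)] [cite: Marcus2018, Ch. 4 Thm. 28] -/
theorem absNorm_eq_minFac_of_inertiaDeg_eq_two (h2K₁ : Module.finrank ℚ K₁ = 2) (h2K : Module.finrank ℚ K = 2)
    (h2L : Module.finrank K L = 2) (h2L₁ : Module.finrank K₁ L = 2) (c : K₁ ≃ₐ[ℚ] K₁) {τ : L ≃ₐ[K] L} (hτ : τ ≠ 1)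
    (hτc : (τ.restrictScalars ℚ).restrictNormal K₁ = c) (θ₀ : 𝓞 K₁) (a : ℤ) (hcθ : c • θ₀ = (a : 𝓞 K₁) - θ₀)
    (hθ : ∀ 𝔮 : HeightOneSpectrum (𝓞 K₁), Ideal.absNorm 𝔮.asIdeal = (Ideal.absNorm 𝔮.asIdeal).minFac ^ 2 →
      (a : 𝓞 K₁) - 2 * θ₀ ∉ 𝔮.asIdeal)
    (w : HeightOneSpectrum (𝓞 L)) (v : HeightOneSpectrum (𝓞 K)) (hw : w.under (𝓞 K) = v)
    (hf : w.asIdeal.inertiaDeg (𝓞 K) = 2) : Ideal.absNorm v.asIdeal = (Ideal.absNorm v.asIdeal).minFac := by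
  -- `N(v) = ℓ^k`, `k ≤ 2`; we show `k = 1`
  obtain ⟨k, hk0, hk2, hℓ, hNv, -⟩ := absNorm_heightOneSpectrum_eq_pow v
  set q : ℕ := Ideal.absNorm v.asIdeal with hq
  set ℓ : ℕ := q.minFac with hℓdef
  rw [h2K] at hk2
  suffices hk1 : k = 1 by rw [hNv, hk1, pow_one]
  by_contra hk1
  have hk : k = 2 := by omega
  -- then `N(w) = ℓ⁴` and the trace `𝔮 = w ∩ 𝓞 K₁` is inert with `f(w|𝔮) = 2`
  have hNw : Ideal.absNorm w.asIdeal = ℓ ^ 4 := by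
    rw [absNorm_eq_pow_inertiaDeg_under hw, hf, ← hq, hNv, hk, ← pow_mul]
  set 𝔮 : HeightOneSpectrum (𝓞 K₁) := w.under (𝓞 K₁) with h𝔮
  set N₁ : ℕ := Ideal.absNorm 𝔮.asIdeal with hN₁
  obtain ⟨g, hg0, hg2, hℓ', hN𝔮, -⟩ := absNorm_heightOneSpectrum_eq_pow 𝔮
  rw [← hN₁] at hℓ' hN𝔮
  set ℓ' : ℕ := N₁.minFac with hℓ'def
  rw [h2K₁] at hg2
  set m : ℕ := w.asIdeal.inertiaDeg (𝓞 K₁) with hm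
  have hNw₁ : Ideal.absNorm w.asIdeal = N₁ ^ m := absNorm_eq_pow_inertiaDeg_under (K := K₁) rfl
  have hm2 : m ≤ 2 := by
    have hid := ncard_mul_ramificationIdx_mul_inertiaDeg_eq_two h2L₁ (rfl : w.under (𝓞 K₁) = 𝔮)
    have h1 : m ∣ 2 := ⟨(𝔮.asIdeal.primesOver (𝓞 L)).ncard * w.asIdeal.ramificationIdx (𝓞 K₁), by rw [← hid, hm]; ring⟩
    exact Nat.le_of_dvd two_pos h1
  -- the residue characteristic of `𝔮` is `ℓ`
  have h14 : ℓ ^ 4 = ℓ' ^ (g * m) := by rw [← hNw, hNw₁, hN𝔮, ← pow_mul]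
  have hℓℓ' : ℓ' = ℓ := by
    have h2 : ℓ ∣ ℓ' ^ (g * m) := h14 ▸ dvd_pow_self ℓ (by norm_num)
    exact ((Nat.prime_dvd_prime_iff_eq hℓ hℓ').mp (hℓ.dvd_of_dvd_pow h2)).symm
  have hgm : g * m = 4 := by
    rw [hℓℓ'] at h14
    exact (Nat.pow_right_injective hℓ.two_le h14).symm
  have hg : g = 2 := by
    interval_cases g <;> omega
  have hN𝔮2 : N₁ = ℓ ^ 2 := by rw [hN𝔮, hℓℓ', hg]
  -- Frobenius at `w` is `τ`: `τ θ₀ − θ₀^{N(v)} ∈ w`, with `N(v) = ℓ² = N(𝔮)`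
  set Θ : 𝓞 L := algebraMap (𝓞 K₁) (𝓞 L) θ₀ with hΘ
  have hfrob := smul_sub_pow_absNorm_mem_of_inertiaDeg_eq_two h2L hτ hw hf Θ
  have hτΘ : τ • Θ = (a : 𝓞 L) - Θ := by
    rw [hΘ, smul_algebraMap_eq, hτc, hcθ, map_sub, map_intCast]
  have hqN : q = N₁ := by rw [hNv, hk, hN𝔮2]
  -- Fermat: `Θ^{N(𝔮)} − Θ ∈ w`
  have hferm : Θ ^ N₁ - Θ ∈ w.asIdeal := by
    have h1 := pow_absNorm_sub_mem 𝔮 θ₀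
    have h2 : algebraMap (𝓞 K₁) (𝓞 L) (θ₀ ^ N₁ - θ₀) ∈ w.asIdeal := by
      have : θ₀ ^ N₁ - θ₀ ∈ (w.under (𝓞 K₁)).asIdeal := h1
      rwa [HeightOneSpectrum.under_asIdeal, Ideal.under_def, Ideal.mem_comap] at this
    rwa [map_sub, map_pow] at h2
  -- hence `a − 2θ₀ ∈ w ∩ 𝓞 K₁ = 𝔮`
  have hmem : (a : 𝓞 L) - 2 * Θ ∈ w.asIdeal := by
    rw [← hq, hqN, hτΘ] at hfrob
    have := w.asIdeal.add_mem hfrob hferm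
    rwa [show (a : 𝓞 L) - Θ - Θ ^ N₁ + (Θ ^ N₁ - Θ) = (a : 𝓞 L) - 2 * Θ by ring] at this
  have hmem₁ : (a : 𝓞 K₁) - 2 * θ₀ ∈ 𝔮.asIdeal := by
    have : algebraMap (𝓞 K₁) (𝓞 L) ((a : 𝓞 K₁) - 2 * θ₀) ∈ w.asIdeal := by
      rw [map_sub, map_mul, map_intCast, map_ofNat]; exact hmem
    have h' : (a : 𝓞 K₁) - 2 * θ₀ ∈ (w.under (𝓞 K₁)).asIdeal := by
      rw [HeightOneSpectrum.under_asIdeal, Ideal.under_def, Ideal.mem_comap]; exact this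
    exact h'
  exact hθ 𝔮 (show N₁ = ℓ' ^ 2 by rw [hℓℓ']; exact hN𝔮2) hmem₁

end Summit.BirchSwinnertonDyer.BirchSwinnertonDyer.Theorems.BiquadraticEisensteinDescentEisensteinHeartFlatCMInertBadKPrimeDeuringOverKPrimeResidueDegree

end
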